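import Mathlib.Analysis.SpecificLimits.Basic
import Literature.NumberTheory.Automorphic.DoubleCosetHaarVolume
import Literature.NumberTheory.Automorphic.JacquetRayHeckeOperator
import Literature.NumberTheory.Automorphic.SphericalNotSquareIntegrableRankOne
import HarnessLib

/-!
# Upper bound for the Cartan shells of a compact open `K₀ ⊇ Z(G)` through an Iwahori-factorised `K ≤ K₀`:
# `μ((K₀ b K₀)Z∕Z) ≤ [K₀ : K] · [K ∩ N : b(K ∩ N)b⁻¹] · μ(K₀Z∕Z)`, the ray form `≤ [K₀ : K] · μ(K₀Z∕Z) · δ_P(a)⁻ᵐ`, and the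
# summability `Σ_m r^{2m} μ((K₀ aᵐ K₀)Z∕Z) < ∞` for `r² < δ_P(a)` (Casselman 1995, Lemma 1.5.1, Thm. 4.4.6 «⇐»)

Topic `NumberTheory/Automorphic`; namespace `Literature.NumberTheory.Automorphic.DoubleCosetIndex` (continues ★ `IwahoriDoubleCosetIndex`, ★
`CompactOpenIndexHaar`, ★ `DoubleCosetHaarVolume`).  THEOREMS ONLY (no definition, no named fact, no instance, no notation, no `sorry`).  Cell
`hodgecm-mathlib`, F0∕P3 «U3-mult», N5 road (★ `UnitaryGroup.U3SquareIntegrableExponents` [Casselman1995, Thm. 4.4.6]), file (R3d) of the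
GROUP∕MEASURE half (seat B-p04 (g31)): the VOLUME input of the «⇐» brick ★ `SphericalCoefficient.isSquareIntegrableModCenter_of_doubleCoset_decay_geometric`
(A-p13 (g27)), whose hypothesis is `Summable (fun n => r ^ (2 * n) * μ.real (mk '' K₀ tⁿ K₀))` for shells of a compact open `K₀ ⊇ Z(G)`.

THE MATHEMATICS.  `K₀` compact open with `Z(G) ≤ K₀` (for `U(3)` at a non-split place: `K₀ = U(3)(𝒪)`, `Z = E¹ · 1`), `K ≤ K₀` a compact open
subgroup with an Iwahori factorisation `K = (K ∩ N̄)(K ∩ M)(K ∩ N)` (★ `IwahoriDatum.factorization`'s shape) and unique `N`-components (`hinj`),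
`b` dominant for `K`.  Then `#(K₀bK₀ ∕ K₀) = [K₀ : K₀ ∩ bK₀b⁻¹] ≤ [K₀ : K ∩ bKb⁻¹] = [K₀ : K]·[K : K ∩ bKb⁻¹] = [K₀ : K]·[K ∩ N : b(K ∩ N)b⁻¹]`
(★ `relIndex_inf_conj_smul_eq_of_factorization`), so with ★ `measure_image_doubleCoset_eq_card_mul` (`Z ≤ K₀`):
`μ((K₀bK₀)Z∕Z) ≤ [K₀ : K]·[K ∩ N : b(K ∩ N)b⁻¹]·μ(K₀Z∕Z)`, and `[K ∩ N : b(K ∩ N)b⁻¹] = δ_P(b)⁻¹` by the radical's Haar measure (★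
`relIndex_conj_smul_inf_eq_of_map_conj`).  Along the ray `b = aᵐ`: `μ(shellₘ) ≤ A · δ_P(a)⁻ᵐ`, hence `Σ r^{2m} μ(shellₘ) < ∞` whenever
`r² · δ_P(a)⁻¹ < 1` — exactly the growth «`meas(K₀ aᵐ K₀) ≍ δ_P(a)⁻ᵐ`» used in the proof of [Casselman1995, Thm. 4.4.6] (⇐).

* §1 `relIndex_conj_smul_le_mul_of_factorization` (pure group theory, finite indices as hypotheses).
* §2 `measure_image_doubleCoset_le_mul` (`Z(G) ≤ K₀`, `μ` left-invariant on `G ⧸ Z(G)`), `…_le_mul_of_map_conj` (with the radical's Haar scaling).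
* §3 `measureReal_image_doubleCoset_pow_le` (ray form `≤ [K₀ : K] · μ.real(K₀Z∕Z) · d⁻¹ ^ m`), **`measure_image_doubleCoset_pow_le_ofReal`**
  (the `hvol` binder of ★ `Representation.isSquareIntegrableModCenter_of_heckeRay_spectrum`, F0P3-p01's R4 «⇐»:
  `μZ (mk '' (K₀ · {aᵐ} · K₀)) ≤ ENNReal.ofReal (C * D ^ m)`, `C = [K₀ : K] μZ.real(K₀Z∕Z)`, `D = d⁻¹`) and
  **`summable_pow_mul_measureReal_image_doubleCoset_pow`** (`r² d⁻¹ < 1 ⇒ Summable (fun m => r ^ (2 * m) * μ.real ((K₀ aᵐ K₀)Z∕Z))`, the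
  `Summable` binder of ★ `SphericalCoefficient.isSquareIntegrableModCenter_of_doubleCoset_decay_geometric`, A-p13's R4 «⇐»).

## References
* [Casselman1995] W. Casselman, *Introduction to the theory of admissible representations of `p`-adic reductive groups* (draft 1 May 1995),
  Prop. 1.4.4 p. 14, §1.5 Lemma 1.5.1 p. 16, Thm. 4.4.6 p. 45.
* [BruhatTits1972] F. Bruhat, J. Tits, *Groupes réductifs sur un corps local I*, Publ. Math. IHÉS 41 (1972), (4.4.4).
* [CartierCorvallis1979] P. Cartier, *Representations of 𝔭-adic groups: a survey*, PSPM 33.1 (1979), §IV.1.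
* [HarishChandra1970] Harish-Chandra (notes by G. van Dijk), *Harmonic analysis on reductive p-adic groups*, LNM 162 (1970), Part I §1.
-/

set_option autoImplicit false

open scoped Pointwise ENNReal NNReal
open MeasureTheory MulAction

namespace Literature.NumberTheory.Automorphic

namespace DoubleCosetIndex

variable {G : Type*} [Group G]

/-! ## §1 `[K₀ : K₀ ∩ bK₀b⁻¹] ≤ [K₀ : K] · [K ∩ N : b(K ∩ N)b⁻¹]` -/

section Group

variable {K₀ K Nbar M N : Subgroup G} {b : G}

/-- **`[K₀ : K₀ ∩ bK₀b⁻¹] ≤ [K₀ : K] · [K ∩ N : b(K ∩ N)b⁻¹]`** for `K ≤ K₀`, `K = (K ∩ N̄)(K ∩ M)(K ∩ N)` Iwahori-factorised with unique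
`N`-components and `b` dominant (`K ∩ bKb⁻¹ ≤ K₀ ∩ bK₀b⁻¹`, `[K₀ : K ∩ bKb⁻¹] = [K₀ : K]·[K : K ∩ bKb⁻¹]`, ★
`relIndex_inf_conj_smul_eq_of_factorization`); finiteness of `[K₀ : K ∩ bKb⁻¹]` is the hypothesis `hfin`.
[cite: Casselman1995, Prop. 1.4.4 p. 14, §1.5 Lemma 1.5.1 p. 16] -/
theorem relIndex_conj_smul_le_mul_of_factorization (hKK₀ : K ≤ K₀)
    (hfac : (K : Set G) = ((K ⊓ Nbar : Subgroup G) : Set G) * ((K ⊓ M : Subgroup G) : Set G) * ((K ⊓ N : Subgroup G) : Set G))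
    (hinj : ∀ nb ∈ Nbar, ∀ m ∈ M, ∀ n ∈ N, ∀ nb' ∈ Nbar, ∀ m' ∈ M, ∀ n' ∈ N, nb * m * n = nb' * m' * n' → n = n')
    (hbM : ∀ m ∈ K ⊓ M, m * b = b * m) (hbKN : ∀ n ∈ K ⊓ N, b * n * b⁻¹ ∈ K)
    (hbNbar : ∀ nb ∈ K ⊓ Nbar, b⁻¹ * nb * b ∈ K ⊓ Nbar) (hbN : ∀ n ∈ N, b⁻¹ * n * b ∈ N) (hbN' : ∀ n ∈ N, b * n * b⁻¹ ∈ N)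
    (hfin : (K ⊓ ConjAct.toConjAct b • K).relIndex K₀ ≠ 0) :
    (ConjAct.toConjAct b • K₀).relIndex K₀ ≤ K.relIndex K₀ * (ConjAct.toConjAct b • (K ⊓ N)).relIndex (K ⊓ N) := by
  have hle : K ⊓ ConjAct.toConjAct b • K ≤ K₀ ⊓ ConjAct.toConjAct b • K₀ := by
    intro x hx
    obtain ⟨hxK, hxb⟩ := Subgroup.mem_inf.1 hx
    refine Subgroup.mem_inf.2 ⟨hKK₀ hxK, ?_⟩
    rw [Subgroup.mem_pointwise_smul_iff_inv_smul_mem] at hxb ⊢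
    exact hKK₀ hxb
  calc (ConjAct.toConjAct b • K₀).relIndex K₀ = (K₀ ⊓ ConjAct.toConjAct b • K₀).relIndex K₀ := (relIndex_inf_conj_smul K₀ b).symm
    _ ≤ (K ⊓ ConjAct.toConjAct b • K).relIndex K₀ := Subgroup.relIndex_le_of_le_left hle hfin
    _ = (K ⊓ ConjAct.toConjAct b • K).relIndex K * K.relIndex K₀ :=
        (Subgroup.relIndex_mul_relIndex (K ⊓ ConjAct.toConjAct b • K) K K₀ inf_le_left hKK₀).symm
    _ = K.relIndex K₀ * (ConjAct.toConjAct b • (K ⊓ N)).relIndex (K ⊓ N) := by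
        rw [relIndex_inf_conj_smul_eq_of_factorization hfac hinj hbM hbKN hbNbar hbN hbN', mul_comm]

end Group

/-! ## §2 Shells of `K₀ ⊇ Z(G)` in `G ⧸ Z(G)`: `μ((K₀bK₀)Z∕Z) ≤ [K₀ : K]·[K ∩ N : b(K ∩ N)b⁻¹]·μ(K₀Z∕Z)` -/

section Shell

variable [TopologicalSpace G] [IsTopologicalGroup G] [LocallyCompactSpace G] [MeasurableSpace G] [BorelSpace G]
  [MeasurableSpace (G ⧸ Subgroup.center G)] [BorelSpace (G ⧸ Subgroup.center G)]
  {K₀ K Nbar M N : Subgroup G} {b : G}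

omit [MeasurableSpace (G ⧸ Subgroup.center G)] [BorelSpace (G ⧸ Subgroup.center G)] in
/-- `[K₀ : K ∩ bKb⁻¹] < ∞` for `K ≤ K₀` compact open subgroups of a locally compact group. [cite: Casselman1995, §1.5 Lemma 1.5.1 p. 16] -/
theorem relIndex_inf_conj_smul_ne_zero_of_le (hKK₀ : K ≤ K₀) (hKo : IsOpen (K : Set G)) (hKc : IsCompact (K : Set G))
    (hK₀c : IsCompact (K₀ : Set G)) (b : G) : (K ⊓ ConjAct.toConjAct b • K).relIndex K₀ ≠ 0 := by
  haveI : (Measure.haar : Measure G).IsHaarMeasure := inferInstance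
  have h1 : (K ⊓ ConjAct.toConjAct b • K).relIndex K ≠ 0 := by
    rw [relIndex_inf_conj_smul]; exact relIndex_conj_smul_ne_zero Measure.haar hKo hKc b
  have h2 : K.relIndex K₀ ≠ 0 :=
    relIndex_ne_zero_of_measure (Measure.haar : Measure G) hKK₀ hKo.measurableSet
      (hKo.measure_pos _ ⟨1, K.one_mem⟩).ne' hK₀c.measure_lt_top.ne
  rw [← Subgroup.relIndex_mul_relIndex (K ⊓ ConjAct.toConjAct b • K) K K₀ inf_le_left hKK₀]
  exact mul_ne_zero h1 h2

/-- **`μ((K₀ b K₀)Z∕Z) ≤ [K₀ : K] · [K ∩ N : b(K ∩ N)b⁻¹] · μ(K₀Z∕Z)`** for a left-invariant measure `μ` on `G ⧸ Z(G)`, `Z(G) ≤ K₀` compact open,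
`K ≤ K₀` compact open Iwahori-factorised with unique `N`-components, `b` dominant for `K`: ★ `measure_image_doubleCoset_eq_card_mul` with
`#X = [K₀ : K₀ ∩ bK₀b⁻¹]` (★ `exists_finset_bijOn_orbit`) and §1. [cite: Casselman1995, §1.5 Lemma 1.5.1 p. 16] [cite: CartierCorvallis1979, §IV.1]
[cite: HarishChandra1970, Part I §1] -/
theorem measure_image_doubleCoset_le_mul (hZK₀ : Subgroup.center G ≤ K₀) (hK₀o : IsOpen (K₀ : Set G)) (hK₀c : IsCompact (K₀ : Set G))
    (hKK₀ : K ≤ K₀) (hKo : IsOpen (K : Set G)) (hKc : IsCompact (K : Set G))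
    (hfac : (K : Set G) = ((K ⊓ Nbar : Subgroup G) : Set G) * ((K ⊓ M : Subgroup G) : Set G) * ((K ⊓ N : Subgroup G) : Set G))
    (hinj : ∀ nb ∈ Nbar, ∀ m ∈ M, ∀ n ∈ N, ∀ nb' ∈ Nbar, ∀ m' ∈ M, ∀ n' ∈ N, nb * m * n = nb' * m' * n' → n = n')
    (hbM : ∀ m ∈ K ⊓ M, m * b = b * m) (hbKN : ∀ n ∈ K ⊓ N, b * n * b⁻¹ ∈ K)
    (hbNbar : ∀ nb ∈ K ⊓ Nbar, b⁻¹ * nb * b ∈ K ⊓ Nbar) (hbN : ∀ n ∈ N, b⁻¹ * n * b ∈ N) (hbN' : ∀ n ∈ N, b * n * b⁻¹ ∈ N)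
    (μ : Measure (G ⧸ Subgroup.center G)) [μ.IsMulLeftInvariant] :
    μ ((QuotientGroup.mk : G → G ⧸ Subgroup.center G) '' DoubleCoset.doubleCoset b (K₀ : Set G) K₀) ≤
      ((K.relIndex K₀ * (ConjAct.toConjAct b • (K ⊓ N)).relIndex (K ⊓ N) : ℕ) : ℝ≥0∞) *
        μ ((QuotientGroup.mk : G → G ⧸ Subgroup.center G) '' (K₀ : Set G)) := by
  haveI : (Measure.haar : Measure G).IsHaarMeasure := inferInstance
  obtain ⟨X, hX, hcard⟩ := exists_finset_bijOn_orbit K₀ b (relIndex_conj_smul_ne_zero Measure.haar hK₀o hK₀c b)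
  rw [SphericalCoefficient.measure_image_doubleCoset_eq_card_mul hZK₀ hK₀o μ hX, hcard]
  gcongr
  exact_mod_cast relIndex_conj_smul_le_mul_of_factorization hKK₀ hfac hinj hbM hbKN hbNbar hbN hbN'
    (relIndex_inf_conj_smul_ne_zero_of_le hKK₀ hKo hKc hK₀c b)

/-- The same bound with the radical's Haar measure: if `N` is closed with a Haar measure `μN` and `μN.map (n ↦ b n b⁻¹) = c • μN`, then
**`μ((K₀ b K₀)Z∕Z) ≤ [K₀ : K] · c · μ(K₀Z∕Z)`** (`c = δ_P(b)⁻¹`, ★ `relIndex_conj_smul_inf_eq_of_map_conj`).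
[cite: Casselman1995, §1.5 Lemma 1.5.1 p. 16, Thm. 4.4.6 p. 45] [cite: BruhatTits1972, (4.4.4)] -/
theorem measure_image_doubleCoset_le_mul_of_map_conj (hZK₀ : Subgroup.center G ≤ K₀) (hK₀o : IsOpen (K₀ : Set G))
    (hK₀c : IsCompact (K₀ : Set G)) (hKK₀ : K ≤ K₀) (hKo : IsOpen (K : Set G)) (hKc : IsCompact (K : Set G))
    (hfac : (K : Set G) = ((K ⊓ Nbar : Subgroup G) : Set G) * ((K ⊓ M : Subgroup G) : Set G) * ((K ⊓ N : Subgroup G) : Set G))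
    (hinj : ∀ nb ∈ Nbar, ∀ m ∈ M, ∀ n ∈ N, ∀ nb' ∈ Nbar, ∀ m' ∈ M, ∀ n' ∈ N, nb * m * n = nb' * m' * n' → n = n')
    (hbM : ∀ m ∈ K ⊓ M, m * b = b * m) (hbKN : ∀ n ∈ K ⊓ N, b * n * b⁻¹ ∈ K)
    (hbNbar : ∀ nb ∈ K ⊓ Nbar, b⁻¹ * nb * b ∈ K ⊓ Nbar) (hbN : ∀ n ∈ N, b⁻¹ * n * b ∈ N) (hbN' : ∀ n ∈ N, b * n * b⁻¹ ∈ N)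
    (hNc : IsClosed (N : Set G)) [MeasurableSpace ↥N] [BorelSpace ↥N] (μN : Measure ↥N) [μN.IsHaarMeasure]
    (ψ : ↥N → ↥N) (hψ : ∀ n : ↥N, ((ψ n : ↥N) : G) = b * n * b⁻¹) {c : ℝ≥0∞} (hμN : μN.map ψ = c • μN)
    (μ : Measure (G ⧸ Subgroup.center G)) [μ.IsMulLeftInvariant] :
    μ ((QuotientGroup.mk : G → G ⧸ Subgroup.center G) '' DoubleCoset.doubleCoset b (K₀ : Set G) K₀) ≤
      (K.relIndex K₀ : ℝ≥0∞) * c * μ ((QuotientGroup.mk : G → G ⧸ Subgroup.center G) '' (K₀ : Set G)) := by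
  have h := measure_image_doubleCoset_le_mul hZK₀ hK₀o hK₀c hKK₀ hKo hKc hfac hinj hbM hbKN hbNbar hbN hbN' μ (b := b)
  rw [Nat.cast_mul, relIndex_conj_smul_inf_eq_of_map_conj hKo hKc hNc μN hbKN hbN hbN' ψ hψ hμN] at h
  exact h

end Shell

/-! ## §3 The ray form and the summability `Σ r^{2m} μ(shellₘ) < ∞` -/

section Ray

variable [TopologicalSpace G] [IsTopologicalGroup G] [LocallyCompactSpace G] [MeasurableSpace G] [BorelSpace G]
  [MeasurableSpace (G ⧸ Subgroup.center G)] [BorelSpace (G ⧸ Subgroup.center G)]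
  {K₀ K Nbar M N : Subgroup G} {a : G}

/-- **The ray bound `μ.real ((K₀ aᵐ K₀)Z∕Z) ≤ [K₀ : K] · μ.real (K₀Z∕Z) · d⁻¹ ^ m`**: `a` dominant for the Iwahori-factorised `K ≤ K₀`
(`[a, K ∩ M] = 1`, `a(K ∩ N)a⁻¹ ⊆ K`, `a⁻¹(K ∩ N̄)a ⊆ K ∩ N̄`, `a^{±1} N a^{∓1} ⊆ N`; powers inherit dominance, ★
`Representation.forall_mul_pow_eq_of_forall_mul_eq` ∕ `forall_pow_inv_mul_mul_pow_mem`), and the radical's Haar measure scaled by the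
conjugations `ψ m` (`(ψ m n : G) = aᵐ n a⁻ᵐ`) as `μN.map (ψ m) = (d⁻¹)ᵐ • μN` (`d = δ_P(a)`).  [cite: Casselman1995, §1.5 Lemma 1.5.1 p. 16, Thm. 4.4.6 p. 45]
[cite: BruhatTits1972, (4.4.4)] -/
theorem measureReal_image_doubleCoset_pow_le (hZK₀ : Subgroup.center G ≤ K₀) (hK₀o : IsOpen (K₀ : Set G))
    (hK₀c : IsCompact (K₀ : Set G)) (hKK₀ : K ≤ K₀) (hKo : IsOpen (K : Set G)) (hKc : IsCompact (K : Set G))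
    (hfac : (K : Set G) = ((K ⊓ Nbar : Subgroup G) : Set G) * ((K ⊓ M : Subgroup G) : Set G) * ((K ⊓ N : Subgroup G) : Set G))
    (hinj : ∀ nb ∈ Nbar, ∀ m ∈ M, ∀ n ∈ N, ∀ nb' ∈ Nbar, ∀ m' ∈ M, ∀ n' ∈ N, nb * m * n = nb' * m' * n' → n = n')
    (haM : ∀ m ∈ K ⊓ M, m * a = a * m) (haKN : ∀ n ∈ K ⊓ N, a * n * a⁻¹ ∈ K)
    (haNbar : ∀ nb ∈ K ⊓ Nbar, a⁻¹ * nb * a ∈ K ⊓ Nbar) (haN : ∀ n ∈ N, a⁻¹ * n * a ∈ N) (haN' : ∀ n ∈ N, a * n * a⁻¹ ∈ N)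
    (hNc : IsClosed (N : Set G)) [MeasurableSpace ↥N] [BorelSpace ↥N] (μN : Measure ↥N) [μN.IsHaarMeasure]
    (ψ : ℕ → ↥N → ↥N) (hψ : ∀ (m : ℕ) (n : ↥N), ((ψ m n : ↥N) : G) = a ^ m * n * (a ^ m)⁻¹)
    {d : ℝ≥0} (hμN : ∀ m : ℕ, μN.map (ψ m) = ((d⁻¹ ^ m : ℝ≥0) : ℝ≥0∞) • μN)
    (μ : Measure (G ⧸ Subgroup.center G)) [μ.IsMulLeftInvariant] [IsFiniteMeasureOnCompacts μ] (m : ℕ) :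
    μ.real ((QuotientGroup.mk : G → G ⧸ Subgroup.center G) '' DoubleCoset.doubleCoset (a ^ m) (K₀ : Set G) K₀) ≤
      (K.relIndex K₀ : ℝ) * μ.real ((QuotientGroup.mk : G → G ⧸ Subgroup.center G) '' (K₀ : Set G)) * ((d : ℝ)⁻¹ ^ m) := by
  have h := measure_image_doubleCoset_le_mul_of_map_conj hZK₀ hK₀o hK₀c hKK₀ hKo hKc hfac hinj
    (Representation.forall_mul_pow_eq_of_forall_mul_eq haM m) (forall_pow_mul_mul_pow_inv_mem_K_of_forall haKN haN' m)
    (Representation.forall_pow_inv_mul_mul_pow_mem haNbar m) (forall_pow_inv_mul_mul_pow_mem_of_forall haN m)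
    (forall_pow_mul_mul_pow_inv_mem_of_forall haN' m) hNc μN (ψ m) (hψ m) (hμN m) μ
  have hcpt : IsCompact ((QuotientGroup.mk : G → G ⧸ Subgroup.center G) '' (K₀ : Set G)) := hK₀c.image continuous_quot_mk
  have hfin : μ ((QuotientGroup.mk : G → G ⧸ Subgroup.center G) '' (K₀ : Set G)) ≠ ∞ := hcpt.measure_lt_top.ne
  have hfin' : (K.relIndex K₀ : ℝ≥0∞) * ((d⁻¹ ^ m : ℝ≥0) : ℝ≥0∞) *
      μ ((QuotientGroup.mk : G → G ⧸ Subgroup.center G) '' (K₀ : Set G)) ≠ ∞ :=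
    ENNReal.mul_ne_top (ENNReal.mul_ne_top (ENNReal.natCast_ne_top _) ENNReal.coe_ne_top) hfin
  have h' := (ENNReal.toReal_le_toReal ((SphericalCoefficient.isCompact_image_doubleCoset hK₀c _).measure_lt_top).ne hfin').2 h
  rw [ENNReal.toReal_mul, ENNReal.toReal_mul, ENNReal.toReal_natCast, ENNReal.coe_toReal, NNReal.coe_pow, NNReal.coe_inv] at h'
  rw [measureReal_def, measureReal_def]
  calc _ ≤ (K.relIndex K₀ : ℝ) * ((d : ℝ)⁻¹ ^ m) * (μ ((QuotientGroup.mk : G → G ⧸ Subgroup.center G) '' (K₀ : Set G))).toReal := h'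
    _ = _ := by ring

/-- **The «⇐» volume hypothesis of ★ `Representation.isSquareIntegrableModCenter_of_heckeRay_spectrum` (F0P3-p01's R4), token-shaped**:
`∀ m, μZ (mk '' (K₀ · {aᵐ} · K₀)) ≤ ENNReal.ofReal (C * D ^ m)` with `C = [K₀ : K] · μZ.real (K₀Z∕Z)` and `D = d⁻¹` (`d = δ_P(a)`), under the
hypotheses of `measureReal_image_doubleCoset_pow_le` (the set `K₀ · {aᵐ} · K₀` is Mathlib's `DoubleCoset.doubleCoset (a ^ m) K₀ K₀` unfolded).
[cite: Casselman1995, §1.5 Lemma 1.5.1 p. 16, Thm. 4.4.6 p. 45] [cite: BruhatTits1972, (4.4.4)] -/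
theorem measure_image_doubleCoset_pow_le_ofReal (hZK₀ : Subgroup.center G ≤ K₀) (hK₀o : IsOpen (K₀ : Set G))
    (hK₀c : IsCompact (K₀ : Set G)) (hKK₀ : K ≤ K₀) (hKo : IsOpen (K : Set G)) (hKc : IsCompact (K : Set G))
    (hfac : (K : Set G) = ((K ⊓ Nbar : Subgroup G) : Set G) * ((K ⊓ M : Subgroup G) : Set G) * ((K ⊓ N : Subgroup G) : Set G))
    (hinj : ∀ nb ∈ Nbar, ∀ m ∈ M, ∀ n ∈ N, ∀ nb' ∈ Nbar, ∀ m' ∈ M, ∀ n' ∈ N, nb * m * n = nb' * m' * n' → n = n')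
    (haM : ∀ m ∈ K ⊓ M, m * a = a * m) (haKN : ∀ n ∈ K ⊓ N, a * n * a⁻¹ ∈ K)
    (haNbar : ∀ nb ∈ K ⊓ Nbar, a⁻¹ * nb * a ∈ K ⊓ Nbar) (haN : ∀ n ∈ N, a⁻¹ * n * a ∈ N) (haN' : ∀ n ∈ N, a * n * a⁻¹ ∈ N)
    (hNc : IsClosed (N : Set G)) [MeasurableSpace ↥N] [BorelSpace ↥N] (μN : Measure ↥N) [μN.IsHaarMeasure]
    (ψ : ℕ → ↥N → ↥N) (hψ : ∀ (m : ℕ) (n : ↥N), ((ψ m n : ↥N) : G) = a ^ m * n * (a ^ m)⁻¹)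
    {d : ℝ≥0} (hμN : ∀ m : ℕ, μN.map (ψ m) = ((d⁻¹ ^ m : ℝ≥0) : ℝ≥0∞) • μN)
    (μ : Measure (G ⧸ Subgroup.center G)) [μ.IsMulLeftInvariant] [IsFiniteMeasureOnCompacts μ] (m : ℕ) :
    μ ((QuotientGroup.mk : G → G ⧸ Subgroup.center G) '' ((K₀ : Set G) * {a ^ m} * (K₀ : Set G))) ≤
      ENNReal.ofReal (((K.relIndex K₀ : ℝ) * μ.real ((QuotientGroup.mk : G → G ⧸ Subgroup.center G) '' (K₀ : Set G))) *
        ((d : ℝ)⁻¹) ^ m) := by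
  have h := measureReal_image_doubleCoset_pow_le hZK₀ hK₀o hK₀c hKK₀ hKo hKc hfac hinj haM haKN haNbar haN haN' hNc μN ψ hψ hμN μ m
  have hfin : μ ((QuotientGroup.mk : G → G ⧸ Subgroup.center G) '' DoubleCoset.doubleCoset (a ^ m) (K₀ : Set G) K₀) ≠ ∞ :=
    ((SphericalCoefficient.isCompact_image_doubleCoset hK₀c _).measure_lt_top).ne
  change μ ((QuotientGroup.mk : G → G ⧸ Subgroup.center G) '' DoubleCoset.doubleCoset (a ^ m) (K₀ : Set G) K₀) ≤ _
  rw [← ENNReal.ofReal_toReal hfin]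
  exact ENNReal.ofReal_le_ofReal h

/-- **`Σ_m r^{2m} · μ((K₀ aᵐ K₀)Z∕Z) < ∞` for `0 ≤ r`, `r² · d⁻¹ < 1`** (`d = δ_P(a)`): comparison with the geometric series
`[K₀ : K] μ(K₀Z∕Z) (r² d⁻¹)^m`.  This is the `Summable` hypothesis of the «⇐» brick ★
`SphericalCoefficient.isSquareIntegrableModCenter_of_doubleCoset_decay_geometric`, which a coefficient bound `|⟨ṽ, π(g)v⟩| ≤ C rᵐ` on
`K₀ aᵐ K₀` with `r < δ_P(a)^{1/2}` then feeds. [cite: Casselman1995, Thm. 4.4.6 p. 45, §1.5 Lemma 1.5.1 p. 16] [cite: HarishChandra1970, Part I §1] -/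
theorem summable_pow_mul_measureReal_image_doubleCoset_pow (hZK₀ : Subgroup.center G ≤ K₀) (hK₀o : IsOpen (K₀ : Set G))
    (hK₀c : IsCompact (K₀ : Set G)) (hKK₀ : K ≤ K₀) (hKo : IsOpen (K : Set G)) (hKc : IsCompact (K : Set G))
    (hfac : (K : Set G) = ((K ⊓ Nbar : Subgroup G) : Set G) * ((K ⊓ M : Subgroup G) : Set G) * ((K ⊓ N : Subgroup G) : Set G))
    (hinj : ∀ nb ∈ Nbar, ∀ m ∈ M, ∀ n ∈ N, ∀ nb' ∈ Nbar, ∀ m' ∈ M, ∀ n' ∈ N, nb * m * n = nb' * m' * n' → n = n')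
    (haM : ∀ m ∈ K ⊓ M, m * a = a * m) (haKN : ∀ n ∈ K ⊓ N, a * n * a⁻¹ ∈ K)
    (haNbar : ∀ nb ∈ K ⊓ Nbar, a⁻¹ * nb * a ∈ K ⊓ Nbar) (haN : ∀ n ∈ N, a⁻¹ * n * a ∈ N) (haN' : ∀ n ∈ N, a * n * a⁻¹ ∈ N)
    (hNc : IsClosed (N : Set G)) [MeasurableSpace ↥N] [BorelSpace ↥N] (μN : Measure ↥N) [μN.IsHaarMeasure]
    (ψ : ℕ → ↥N → ↥N) (hψ : ∀ (m : ℕ) (n : ↥N), ((ψ m n : ↥N) : G) = a ^ m * n * (a ^ m)⁻¹)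
    {d : ℝ≥0} (hμN : ∀ m : ℕ, μN.map (ψ m) = ((d⁻¹ ^ m : ℝ≥0) : ℝ≥0∞) • μN)
    (μ : Measure (G ⧸ Subgroup.center G)) [μ.IsMulLeftInvariant] [IsFiniteMeasureOnCompacts μ]
    {r : ℝ} (hr : 0 ≤ r) (hrd : r ^ 2 * (d : ℝ)⁻¹ < 1) :
    Summable (fun m : ℕ => r ^ (2 * m) *
      μ.real ((QuotientGroup.mk : G → G ⧸ Subgroup.center G) '' DoubleCoset.doubleCoset (a ^ m) (K₀ : Set G) K₀)) := by
  set A : ℝ := (K.relIndex K₀ : ℝ) * μ.real ((QuotientGroup.mk : G → G ⧸ Subgroup.center G) '' (K₀ : Set G)) with hA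
  have hA0 : 0 ≤ A := mul_nonneg (Nat.cast_nonneg _) measureReal_nonneg
  have hq0 : 0 ≤ r ^ 2 * (d : ℝ)⁻¹ := mul_nonneg (pow_nonneg hr 2) (inv_nonneg.2 d.2)
  refine Summable.of_nonneg_of_le (fun m => mul_nonneg (pow_nonneg hr _) measureReal_nonneg) (fun m => ?_)
    ((summable_geometric_of_lt_one hq0 hrd).mul_left A)
  have h := measureReal_image_doubleCoset_pow_le hZK₀ hK₀o hK₀c hKK₀ hKo hKc hfac hinj haM haKN haNbar haN haN' hNc μN ψ hψ hμN μ m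
  calc r ^ (2 * m) * μ.real ((QuotientGroup.mk : G → G ⧸ Subgroup.center G) '' DoubleCoset.doubleCoset (a ^ m) (K₀ : Set G) K₀)
      ≤ r ^ (2 * m) * (A * ((d : ℝ)⁻¹ ^ m)) := by gcongr
    _ = A * (r ^ 2 * (d : ℝ)⁻¹) ^ m := by rw [mul_pow, ← pow_mul]; ring

end Ray

end DoubleCosetIndex

end Literature.NumberTheory.Automorphic
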